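import Literature.AnabelianGeometry.SemiGraphs.ProSigmaCompletionProfiniteExtend
import Literature.AnabelianGeometry.SemiGraphs.ProSigmaCompletionExtend
import Literature.AnabelianGeometry.AbsoluteAnabelian.ZHatCompletionFreeProcyclic
import Literature.AnabelianGeometry.EtaleTheta.ZHatLevelDetermination
import HarnessLib

/-!
# Twisting one free generator by a unit of `Ẑ` preserves "pro-`Σ` completion": the profinite
# automorphism `s ↦ s^λ` of a pro-`Σ` completion of a free group

Mochizuki, *Semi-graphs of anabelioids* [SemiAnbd] Example 2.10 p. 31 (pro-`Σ` completions
`ι : Γ → P` of free / punctured surface groups, the tree's interface `IsProSigmaCompletion`); Ribes–Zalesskii,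
*Profinite Groups*, Thm 2.7.1 (`Ẑ`, its units `Ẑ^× = Aut(Ẑ)`; the tree's `ZHatLevel` vocabulary).

PROOF-ONLY file (abc-iut cell, block F, seat abc-iut-f-090 (gen 5); L-F [AbsTop*] row «F-0206
`CuspidalAlgorithm.RecoversCusps` tightness at the once-punctured torus», consumer
`ProSigmaSurfaceCuspZHatTwist.lean`).  Classical profinite group theory:

* `zhat_monoidHom_apply_eq_pow` — a homomorphism `h : Ẑ → M` into a group killed by `e`-th powers is
  `t ↦ h(η 1)^{(t mod e)}` (`Ker(Ẑ → ℤ/e) = Ẑ^e`, `ZHatLevel.level_eq_one_iff_exists_pow`);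
* **`twistGenerator`** — let `ι : F(L) → Q` be a pro-`Σ` completion of the free group on `L` (`Q` profinite),
  `s ∈ L`, `x^· : Ẑ → Q` the continuous one-parameter group through `ι(s)`
  (`ZHatCompletion.exists_continuousMonoidHom_apply_eq`) and `φ ∈ Aut(Ẑ) = Ẑ^×`.  Then the homomorphism
  `κ_φ : F(L) → Q`, `s ↦ ι(s)^{φ(η 1)}`, `t ↦ ι(t)` (`t ≠ s`), is AGAIN a pro-`Σ` completion of `F(L)`:
  DENSE image (the closed subgroup it generates contains `ι(s)^{φ(Ẑ)} ∋ ι(s)`, as `η(ℤ)` is dense in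
  `Ẑ`), the SAME open normal subgroups, and every finite `Σ`-quotient `F(L) ↠ M` is a pull-back (twist
  the value at `s` back by the inverse residue `χ_e(φ⁻¹)`, `e = |M|`, extend through `ι`, and read
  `Ψ(ι(s)^λ) = Ψ(ι s)^{χ_e(φ)}` off the first bullet).  By the uniqueness of pro-`Σ` completions
  (`IsProSigmaCompletion.exists_continuousMulEquiv`) this yields a CONTINUOUS AUTOMORPHISM `ê` of `Q`
  with `ê(ι s) = ι(s)^λ`, `ê(ι t) = ι(t)` — NOT induced by any automorphism of the discrete `F(L)` when
  `λ ≠ ±1` (`exists_continuousMulEquiv_twistGenerator`).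

HONEST FRAMING: elementary; used to show that the boundary class of the once-punctured torus is moved
by a continuous automorphism of its pro-`Σ` fundamental group; nothing here bears on [IUTchIII]
Cor. 3.12; no abc claim.
-/

noncomputable section

namespace Literature.AnabelianGeometry.SemiGraphs.SemiGraphOfAnabelioids.IsProSigmaCompletion

open CategoryTheory ProfiniteGrp ProfiniteGrp.ProfiniteCompletion
open Literature.AnabelianGeometry.EtaleTheta
open Literature.AnabelianGeometry.AbsoluteAnabelian (ZHatCompletion.exists_continuousMonoidHom_apply_eq
  ZHatCompletion.dense_zpowers_eta_one)

/-! ### Homomorphisms out of `Ẑ` into groups of finite exponent -/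

/-- **A homomorphism `h : Ẑ → M` into a group killed by `e`-th powers only sees `t mod e`**:
`h(t) = h(η 1)^{(χ_e t)}` where `χ_e = ZHatLevel.level e` (write `t = z^e · η(k)` by
`Ker(Ẑ → ℤ/e) = Ẑ^e`).  No continuity is needed. [cite: RibesZalesskii2010, Thm 2.7.1] -/
theorem zhat_monoidHom_apply_eq_pow {M : Type*} [Group M]
    (h : completion (GrpCat.of (Multiplicative ℤ)) →* M) (e : ℕ+) (he : ∀ m : M, m ^ (e : ℕ) = 1)
    (t : completion (GrpCat.of (Multiplicative ℤ))) :
    h t = h (ZHatLevel.eta 1) ^ (Multiplicative.toAdd (ZHatLevel.level e t)).val := by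
  haveI : NeZero (e : ℕ) := ⟨e.ne_zero⟩
  set k : ℕ := (Multiplicative.toAdd (ZHatLevel.level e t)).val with hkdef
  have hk : ZHatLevel.level e t = ZHatLevel.level e (ZHatLevel.eta (k : ℤ)) := by
    rw [ZHatLevel.level_eta, Int.cast_natCast, hkdef, ZMod.natCast_zmod_val, ofAdd_toAdd]
  have h1 : ZHatLevel.level e (t * (ZHatLevel.eta (k : ℤ))⁻¹) = 1 := by
    rw [map_mul, map_inv, hk, mul_inv_cancel]
  obtain ⟨z, hz⟩ := (ZHatLevel.level_eq_one_iff_exists_pow e _).mp h1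
  have ht : t = z ^ (e : ℕ) * ZHatLevel.eta (k : ℤ) := by rw [hz, inv_mul_cancel_right]
  rw [ht, map_mul, map_pow, he, one_mul, ZHatLevel.eta_eq_zpow (k : ℤ), map_zpow, zpow_natCast]

/-- A continuous one-parameter group `x^· : Ẑ → Q` followed by a homomorphism `F : Q → M` into a group
killed by `e`-th powers: `F(x^t) = F(x)^{(χ_e t)}`. [cite: RibesZalesskii2010, Thm 2.7.1] -/
theorem apply_zhatPow_eq_pow {Q : Type*} [Group Q] [TopologicalSpace Q] {M : Type*} [Group M]
    (P : completion (GrpCat.of (Multiplicative ℤ)) →ₜ* Q) (F : Q →* M) (e : ℕ+)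
    (he : ∀ m : M, m ^ (e : ℕ) = 1) (t : completion (GrpCat.of (Multiplicative ℤ))) :
    F (P t) = F (P (ZHatLevel.eta 1)) ^ (Multiplicative.toAdd (ZHatLevel.level e t)).val :=
  zhat_monoidHom_apply_eq_pow (F.comp P.toMonoidHom) e he t

/-- For an automorphism `φ` of `Ẑ` and a group `M` killed by `e`-th powers: the residues `χ_e(φ)`,
`χ_e(φ⁻¹)` are inverse, so `m^{χ_e(φ⁻¹)·χ_e(φ)} = m`. [cite: RibesZalesskii2010, Thm 2.7.1] -/
theorem pow_levelChar_inv_mul_levelChar {M : Type*} [Group M] (e : ℕ+) (he : ∀ m : M, m ^ (e : ℕ) = 1)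
    (φ : MulAut (completion (GrpCat.of (Multiplicative ℤ)))) (m : M) :
    (m ^ (ZHatLevel.levelChar e φ⁻¹).val) ^ (ZHatLevel.levelChar e φ).val = m := by
  haveI : NeZero (e : ℕ) := ⟨e.ne_zero⟩
  rw [← pow_mul]
  have hmod : ((ZHatLevel.levelChar e φ⁻¹).val * (ZHatLevel.levelChar e φ).val) % (e : ℕ) =
      1 % (e : ℕ) := by
    have h1 : ZHatLevel.levelChar e φ⁻¹ * ZHatLevel.levelChar e φ = 1 := by
      rw [mul_comm]; exact ZHatLevel.levelChar_mul_levelChar_inv e φ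
    have h2 : (((ZHatLevel.levelChar e φ⁻¹).val * (ZHatLevel.levelChar e φ).val : ℕ) : ZMod e) =
        ((1 : ℕ) : ZMod e) := by
      rw [Nat.cast_mul, ZMod.natCast_zmod_val, ZMod.natCast_zmod_val, h1, Nat.cast_one]
    exact (ZMod.natCast_eq_natCast_iff' _ _ _).mp h2
  rw [pow_eq_pow_mod _ (he m), hmod, ← pow_eq_pow_mod _ (he m), pow_one]

/-! ### The twisted completion -/

section Twist

variable {Sigma : Set ℕ} {L : Type*} [DecidableEq L] {Q : Type} [Group Q] [TopologicalSpace Q]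
  [IsTopologicalGroup Q] [CompactSpace Q] [TotallyDisconnectedSpace Q] {ι : FreeGroup L →* Q}

/-- **Twisting one free generator by a unit of `Ẑ` preserves `IsProSigmaCompletion`.**  For a pro-`Σ`
completion `ι : F(L) → Q` (`Q` profinite), `s ∈ L`, the continuous one-parameter group `P = ι(s)^· : Ẑ → Q`
and `φ ∈ Aut(Ẑ)`, the homomorphism `κ_φ : s ↦ ι(s)^{φ(η 1)}`, `t ↦ ι(t)` (`t ≠ s`) is a pro-`Σ`
completion of `F(L)`. [cite: MochizukiSemiAnbd2006, Ex. 2.10 p.31] -/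
theorem twistGenerator (hι : IsProSigmaCompletion Sigma ι) (s : L)
    (P : completion (GrpCat.of (Multiplicative ℤ)) →ₜ* Q) (hP : P (ZHatLevel.eta 1) = ι (FreeGroup.of s))
    (φ : MulAut (completion (GrpCat.of (Multiplicative ℤ)))) :
    IsProSigmaCompletion Sigma
      (FreeGroup.lift fun t => if t = s then P (φ (ZHatLevel.eta 1)) else ι (FreeGroup.of t)) := by
  classical
  set κ : FreeGroup L →* Q :=
    FreeGroup.lift fun t => if t = s then P (φ (ZHatLevel.eta 1)) else ι (FreeGroup.of t) with hκdef
  have hκs : κ (FreeGroup.of s) = P (φ (ZHatLevel.eta 1)) := by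
    rw [hκdef, FreeGroup.lift_apply_of, if_pos rfl]
  have hκt : ∀ t, t ≠ s → κ (FreeGroup.of t) = ι (FreeGroup.of t) := fun t ht => by
    rw [hκdef, FreeGroup.lift_apply_of, if_neg ht]
  refine ⟨?_, hι.index_open, ?_⟩
  · -- DENSITY: the closed subgroup `H` generated by the image contains every `ι(t)`
    let H : Subgroup Q := κ.range.topologicalClosure
    have hHc : IsClosed (H : Set Q) := Subgroup.isClosed_topologicalClosure _
    -- `P (φ (η m)) ∈ range κ` for all integers `m`, hence `P ∘ φ` maps `Ẑ` into `H`
    have hPφ : ∀ z : completion (GrpCat.of (Multiplicative ℤ)), P (φ z) ∈ H := by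
      have hsub : (Subgroup.zpowers (etaFn (GrpCat.of (Multiplicative ℤ))
          (Multiplicative.ofAdd (1 : ℤ) : Multiplicative ℤ)) :
            Set (completion (GrpCat.of (Multiplicative ℤ)))) ⊆ (fun z => P (φ z)) ⁻¹' (H : Set Q) := by
        rintro _ ⟨m, rfl⟩
        change P (φ (ZHatLevel.eta 1 ^ m)) ∈ H
        rw [map_zpow, map_zpow]
        exact H.zpow_mem (Subgroup.le_topologicalClosure _ ⟨FreeGroup.of s, hκs⟩) m
      have hcont : Continuous fun z => P (φ z) :=
        P.continuous.comp (ZHatLevel.continuous_mulEquiv φ).1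
      have hclosed : IsClosed ((fun z => P (φ z)) ⁻¹' (H : Set Q)) := hHc.preimage hcont
      have huniv : (fun z => P (φ z)) ⁻¹' (H : Set Q) = Set.univ := by
        have h := closure_minimal hsub hclosed
        rw [ZHatCompletion.dense_zpowers_eta_one.closure_eq] at h
        exact Set.eq_univ_of_univ_subset h
      intro z
      have : z ∈ (fun z => P (φ z)) ⁻¹' (H : Set Q) := by rw [huniv]; exact Set.mem_univ z
      exact this
    have hιs : ι (FreeGroup.of s) ∈ H := by
      have := hPφ (φ.symm (ZHatLevel.eta 1))
      rwa [MulEquiv.apply_symm_apply, hP] at this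
    have hgen : ∀ t, ι (FreeGroup.of t) ∈ H := fun t => by
      by_cases ht : t = s
      · rw [ht]; exact hιs
      · rw [← hκt t ht]; exact Subgroup.le_topologicalClosure _ ⟨FreeGroup.of t, rfl⟩
    have hrange : ι.range ≤ H := by
      have hι' : ι = FreeGroup.lift fun t => ι (FreeGroup.of t) := (FreeGroup.lift.apply_symm_apply ι).symm
      rw [hι', FreeGroup.range_lift_eq_closure, Subgroup.closure_le]
      rintro _ ⟨t, rfl⟩
      exact hgen t
    have hHtop : (H : Set Q) = Set.univ := by
      refine Set.eq_univ_of_univ_subset ?_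
      rw [← hι.dense.closure_eq]
      exact closure_minimal (fun x ⟨γ, hγ⟩ => hrange ⟨γ, hγ⟩) hHc
    rw [dense_iff_closure_eq]
    have : closure (Set.range κ) = (H : Set Q) := (Subgroup.topologicalClosure_coe (s := κ.range)).symm
    rw [this, hHtop]
  · -- UNIVERSALITY: finite `Σ`-quotients of `F(L)` are pull-backs along `κ`
    intro N hN hidx
    haveI := hN
    haveI : N.FiniteIndex := ⟨hidx.1.ne'⟩
    let M := FreeGroup L ⧸ N
    haveI : Finite M := Subgroup.finite_quotient_of_finiteIndex
    letI : TopologicalSpace M := ⊥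
    haveI : DiscreteTopology M := ⟨rfl⟩
    let e : ℕ+ := ⟨Nat.card M, Nat.card_pos⟩
    have he : ∀ m : M, m ^ (e : ℕ) = 1 := fun m => pow_card_eq_one'
    let π : FreeGroup L →* M := QuotientGroup.mk' N
    let μ : ℕ := (ZHatLevel.levelChar e φ⁻¹).val
    -- the back-twisted finite quotient and its continuous extension through `ι`
    let ψ : FreeGroup L →* M :=
      FreeGroup.lift fun t => if t = s then π (FreeGroup.of s) ^ μ else π (FreeGroup.of t)
    have hM : Anabelioids.IsSigmaInteger Sigma (Nat.card M) := hidx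
    obtain ⟨Ψ, hΨc, hΨ⟩ := hι.exists_continuous_extend_top hM ψ
    refine ⟨Ψ.ker, ?_, ?_⟩
    · have : (Ψ.ker : Set Q) = Ψ ⁻¹' {1} := by ext x; simp [MonoidHom.mem_ker]
      rw [this]
      exact (isOpen_discrete _).preimage hΨc
    · -- `Ψ ∘ κ = π`
      have hcomp : Ψ.comp κ = π := by
        refine FreeGroup.ext_hom _ _ fun t => ?_
        rw [MonoidHom.comp_apply]
        by_cases ht : t = s
        · subst ht
          rw [hκs, apply_zhatPow_eq_pow P Ψ e he, hP, hΨ, FreeGroup.lift_apply_of, if_pos rfl,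
            ← ZHatLevel.levelChar_apply]
          exact pow_levelChar_inv_mul_levelChar e he φ _
        · rw [hκt t ht, hΨ, FreeGroup.lift_apply_of, if_neg ht]
      rw [MonoidHom.comap_ker, hcomp]
      exact QuotientGroup.ker_mk' N

/-- **The profinite twist automorphism.**  For a pro-`Σ` completion `ι : F(L) → Q` of a free group
(`Q` profinite), a letter `s` and `φ ∈ Aut(Ẑ)`: there are a continuous one-parameter group
`P = ι(s)^· : Ẑ → Q` through `ι(s)` and a continuous automorphism `ê` of `Q` with `ê(ι s) = P(φ(η 1))`
("`ι(s)^λ`, `λ = φ(η 1) ∈ Ẑ^×`") and `ê(ι t) = ι(t)` for `t ≠ s`.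
[cite: MochizukiSemiAnbd2006, Ex. 2.10 p.31] -/
theorem exists_continuousMulEquiv_twistGenerator (hι : IsProSigmaCompletion Sigma ι) (s : L)
    (φ : MulAut (completion (GrpCat.of (Multiplicative ℤ)))) :
    ∃ (P : completion (GrpCat.of (Multiplicative ℤ)) →ₜ* Q) (e : Q ≃ₜ* Q),
      P (ZHatLevel.eta 1) = ι (FreeGroup.of s) ∧ e (ι (FreeGroup.of s)) = P (φ (ZHatLevel.eta 1)) ∧
        ∀ t, t ≠ s → e (ι (FreeGroup.of t)) = ι (FreeGroup.of t) := by
  classical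
  obtain ⟨P, hP⟩ := ZHatCompletion.exists_continuousMonoidHom_apply_eq (ι (FreeGroup.of s))
  obtain ⟨e, he⟩ := hι.exists_continuousMulEquiv (twistGenerator hι s P hP φ)
  refine ⟨P, e, hP, ?_, fun t ht => ?_⟩
  · rw [he, FreeGroup.lift_apply_of, if_pos rfl]
  · rw [he, FreeGroup.lift_apply_of, if_neg ht]

end Twist

end Literature.AnabelianGeometry.SemiGraphs.SemiGraphOfAnabelioids.IsProSigmaCompletion

end
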